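import Summits.ABC.IUTFork.LDHPerPrimeReadingSlotConstant
import Summits.ABC.IUTFork.LDHSyntheticCor312Holds
import HarnessLib

/-!
# The fork at [IUTchIII] Corollary 3.12, L-DH level: `Cor312Of` is CONTENTFUL at the input type over ANY base field (twin of
# `LDHSyntheticCor312Holds` without the degree-one hypothesis)

Record-only file (D-0012) of the abc-iut cell (WAVE-5 prover abc-iut-w5-d157); TAKES NO SIDE on Cor. 3.12. The ANY-BASE twin of
`LDHSyntheticCor312Holds` (which carried `[F₀:ℚ] = 1`), over `LDHPerPrimeReadingSlotConstant` (`deepAt_localQMass'`: `Q_p = N·log p` by the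
fundamental identity; `exists_deepAt_not_cor312Of'`):
* `ThetaVolumeInput.cor312Of_deepAt_of_shallow'` — over ANY number fields `F₀ ⊆ K` and section: `(c_l − 1)·N·log p ≤ ((l+5)/4)·log π`
  implies `Cor312Of` for the synthetic input `deepAt p l N σ` (Θ-side `≥ −c_l·N·log p + ((l+5)/4)·log π` by
  `DHData.lnνLp_region_tΘ_le_negLogThetaLoc`, other support primes `≥ 0`, `q`-side `−N·log p`);
* `cor312Of_deepAt_three_five_one'` — the instance `p = 3`, `l = 5`, `N = 1` (`(3/2)·log 3 ≤ (5/2)·log π`);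
* `cor312Of_independent'` — `(∃ input, Cor312Of) ∧ (∃ input, ¬ Cor312Of)` at EVERY `(F₀, K, σ)`: the claim form is neither a tautology nor a
  contradiction of the genuine-completion volume formalism, with no restriction on the base field.
HONEST SCOPE: synthetic inhabitants of the input TYPE (pilot data `j_E = p^{−2lN}`), not the Θ-volume inputs of initial Θ-data; nothing
here bears on whether [IUTchIII] Thm. 3.11 licenses (1.1). [cite: DupuyHilado2025, §1 (1.1), Thm. 3.10.1, §4.10–4.12]
[cite: Mochizuki2012, IUTchIV Thm. 1.10 Step (vii) p. 30] [claim: Mochizuki2012, status: disputed] for every IUT quotation.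
-/

noncomputable section

open Set NumberField IsDedekindDomain Literature.IUT.LogVolume

namespace Summit.ABC.IUTFork

variable {F₀ : Type} [Field F₀] [NumberField F₀] {K : Type} [Field K] [NumberField K] [Algebra F₀ K]



namespace ThetaVolumeInput

variable (p : ℕ) [hp : Fact p.Prime] (l : ℕ) (hl : l.Prime) (h5 : 5 ≤ l) (N : ℕ) (hN : 0 < N) (σ : PlaceSection F₀ K)

/-- **`Cor312Of` HOLDS for the synthetic input at SHALLOW depth**: if `(c_l − 1)·N·log p ≤ ((l+5)/4)·log π` then
`−|log(q)| ≤ −|log(Θ)|` for `deepAt p l N σ`, over ANY base — the archimedean summand of Step (vii) pays for the local deficit at `p`,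
and every other support prime contributes `≥ 0`. [cite: Mochizuki2012, IUTchIV Thm. 1.10 Step (vii) p. 30]
[cite: DupuyHilado2025, §1 (1.1), Thm. 3.10.1] [claim: Mochizuki2012, status: disputed] -/
theorem cor312Of_deepAt_of_shallow'
    (hsmall : (((((l - 1) / 2 : ℕ) : ℝ) + 1) * (2 * (((l - 1) / 2 : ℕ) : ℝ) + 1) / 6 - 1) * ((N : ℝ) * Real.log p) ≤
      ThetaVolumeInput.archLogTheta l) :
    (deepAt p l hl h5 N hN σ).Cor312Of := by
  set I := deepAt p l hl h5 N hN σ with hI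
  obtain ⟨w, hw⟩ := placesOver_nonempty F₀ p
  have hpT : p ∈ I.supportPrimes := by
    have := I.residueChar_mem_supportPrimes (v := w) hw
    rwa [(mem_placesOver_iff_residueChar w).mp hw] at this
  have hLI : ((I.X.lstar : ℕ) : ℝ) = (((l - 1) / 2 : ℕ) : ℝ) := by rw [show I.X.lstar = (l - 1) / 2 from rfl]
  -- at `p`: the bare region bounds the hull from below
  have hθp : -(((((l - 1) / 2 : ℕ) : ℝ) + 1) * (2 * (((l - 1) / 2 : ℕ) : ℝ) + 1) / 6 * ((N : ℝ) * Real.log p)) ≤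
      I.negLogThetaLoc p := by
    have h := DHData.lnνLp_region_tΘ_le_negLogThetaLoc I hp.out
    rw [deepAt_localQMass' p l hl h5 N hN σ, hLI] at h
    exact h
  -- elsewhere: nonnegative summands
  have hothers : ∀ p' ∈ I.supportPrimes.erase p, 0 ≤ I.negLogThetaLoc p' := fun p' hp' => by
    haveI : Fact p'.Prime := ⟨I.prime_of_mem_supportPrimes (Finset.mem_of_mem_erase hp')⟩
    exact DHData.negLogThetaLoc_nonneg_of_localQMass_eq_zero I (I.prime_of_mem_supportPrimes (Finset.mem_of_mem_erase hp'))
      (deepAt_localQMass_eq_zero p l hl h5 N hN σ (Finset.ne_of_mem_erase hp'))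
  have hsum : -(((((l - 1) / 2 : ℕ) : ℝ) + 1) * (2 * (((l - 1) / 2 : ℕ) : ℝ) + 1) / 6 * ((N : ℝ) * Real.log p)) ≤
      I.negLogThetaNonarch := by
    rw [ThetaVolumeInput.negLogThetaNonarch, ← Finset.add_sum_erase _ _ hpT]
    have := Finset.sum_nonneg hothers
    linarith
  show I.negAbsLogQ ≤ I.negLogThetaNonarch + ThetaVolumeInput.archLogTheta I.l
  rw [deepAt_negAbsLogQ' p l hl h5 N hN σ, show I.l = l from rfl]
  linarith

/-- **The instance `p = 3`, `l = 5`, `N = 1`**: `Cor312Of` holds for `deepAt 3 5 1 σ` over any number fields `F₀ ⊆ K` and section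
(`c_5 − 1 = 3/2`, `(3/2)·log 3 ≤ (5/2)·log π` since `3 < π`). [cite: Mochizuki2012, IUTchIV Thm. 1.10 Step (vii) p. 30]
[claim: Mochizuki2012, status: disputed] -/
theorem cor312Of_deepAt_three_five_one' (σ : PlaceSection F₀ K) :
    (@deepAt F₀ _ _ K _ _ _ 3 ⟨Nat.prime_three⟩ 5 Nat.prime_five le_rfl 1 Nat.one_pos σ).Cor312Of := by
  refine @cor312Of_deepAt_of_shallow' F₀ _ _ K _ _ _ 3 ⟨Nat.prime_three⟩ 5 Nat.prime_five le_rfl 1 Nat.one_pos σ ?_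
  have h3 : Real.log (3 : ℝ) ≤ Real.log Real.pi := Real.log_le_log (by norm_num) Real.pi_gt_three.le
  have hlog3 : 0 ≤ Real.log (3 : ℝ) := Real.log_nonneg (by norm_num)
  rw [ThetaVolumeInput.archLogTheta]
  norm_num
  nlinarith

/-- **THE CLAIM FORM IS CONTENTFUL AT THE INPUT TYPE**: over any number fields `F₀ ⊆ K` and section `σ` there are synthetic Θ-volume
inputs for which `Cor312Of` HOLDS and others for which it FAILS — it is neither a tautology nor a contradiction of the
genuine-completion volume formalism. [cite: DupuyHilado2025, §1 (1.1)] [claim: Mochizuki2012, status: disputed] -/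
theorem cor312Of_independent' (σ : PlaceSection F₀ K) :
    (∃ I : ThetaVolumeInput F₀ K, I.Cor312Of) ∧ (∃ I : ThetaVolumeInput F₀ K, ¬ I.Cor312Of) := by
  refine ⟨⟨_, cor312Of_deepAt_three_five_one' σ⟩, ?_⟩
  obtain ⟨N, hN, h⟩ := @exists_deepAt_not_cor312Of' F₀ _ _ K _ _ _ 3 ⟨Nat.prime_three⟩ 5 Nat.prime_five le_rfl σ
  exact ⟨_, h⟩

end ThetaVolumeInput

end Summit.ABC.IUTFork

end
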